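import Summits.CriticalPhenomena.PercolationContinuityZ3.Theorems.Transplant.FKConnectivityAllQAntipodalX2DualRows
import Summits.CriticalPhenomena.PercolationContinuityZ3.Theorems.Transplant.FKConnectivityAllQAntipodalX2Pos
import HarnessLib

/-!
# Connectivity correlation inequalities for `φ_{w,q}` — the dual cross functional, file 3: SEMANTICS WITH THE MARKED EDGE OPEN and with
# the TERMINALS WIRED, through the dual word

Helper file (`--supports stmt-CriticalPhenomena-4575`), FK sub-lane `prim-bschramm-fk-2` (gen 14); builds on p205010 (kernel theorem,
internal audit signed; external expert review pending).  No definitions, no named facts, no sorries; standard axioms.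

For the spine `ps` of the marked edge `z = uv` (`FK.IsSpine ps {z} u v E s t`) and a configuration `ω ⊆ E` avoiding `z` (gen 14's row semantics
`…X2SpineSem`, now read with the inner composite `{z}` OPEN, i.e. initial flag `true`, and with the pair automaton's final state `D`):
* `FK.IsSpine.apConn_insert_marked_eq` — `1{s ↔ t in ω ∪ z} = lastFlag true (rowOf ps ω)`;
* `FK.IsSpine.clusterCount_insert_marked` — `k(ω ∪ z) + L·|V| = (|V| - 1) + Σ_p k(ω ∩ R_p) + adjP true (rowOf ps ω)`;
* `FK.IsSpine.apConn_insert_terminals_eq` — `1{u ↔ v in ω ∪ st} = 1{runK S (rowOf ps ω) ≠ D}` (the pair dies iff the first visible part is a wall);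
and, through the DUAL WORD `(spineWord ps T C).map dualLetter` (`…X2DualRows`): `1{s ↮ t in C ∪ z} = lastP (row A of the dual word)`,
`1{u ↔ v in (T∖C) ∪ st} = ¬ headP (row B of the dual word)` (`FK.IsSpine.dual_sign_A/B`), and the exponent identity on the support
`k(C∪z) + k((T∖C)∪z) + 1{s↔t in (T∖C)∪z} + 2L|V| + sRuns(dual w) + 2·#series = 2|V| + expSum + onesCount w + nP(dual w)`
(`FK.IsSpine.dual_exponent_identity`).
[cite: Grimmett2006, §1.4 eq. (1.20) (p. 15); §3.9 (p. 63)]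
-/

noncomputable section

namespace Summit.CriticalPhenomena.PercolationContinuityZ3.Theorems

namespace FK

open SimpleGraph Literature.Probability.LatticeModels Literature.Probability.Percolation X2Word
open scoped Classical

variable {V : Type*}

/-! ### Inserting the marked edge does not change the word -/

/-- The bit of a part does not see edges outside the part. [folklore] -/
theorem SpinePart.bit_insert_of_notMem (p : SpinePart V) {z : Sym2 V} (hz : z ∉ p.R) (ω : Finset (Sym2 V)) :
    p.bit (insert z ω) = p.bit ω := by
  unfold SpinePart.bit
  rw [Finset.insert_inter_of_notMem hz]

/-- The row word does not see the marked edge. [folklore] -/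
theorem rowOf_insert_of_notMem {ps : List (SpinePart V)} {z : Sym2 V} (hz : ∀ p ∈ ps, z ∉ p.R) (ω : Finset (Sym2 V)) :
    rowOf ps (insert z ω) = rowOf ps ω := by
  induction ps with
  | nil => rfl
  | cons p ps ih =>
    rw [rowOf_cons, rowOf_cons, ih (fun p' hp' => hz p' (List.mem_cons_of_mem _ hp')),
      p.bit_insert_of_notMem (hz p List.mem_cons_self)]

section Marked

variable {ps : List (SpinePart V)} {E : Finset (Sym2 V)} {s t u v : V}

/-- Along the spine of the marked edge no part contains it. [folklore] -/
theorem IsSpine.marked_notMem_parts (h : IsSpine ps {s(u, v)} u v E s t) : ∀ p ∈ ps, s(u, v) ∉ p.R :=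
  fun p hp hz => Finset.disjoint_left.1 (h.disjoint_parts p hp) (Finset.mem_singleton_self _) hz

/-- The marked edge lies in the outer network. [folklore] -/
theorem IsSpine.marked_mem (h : IsSpine ps {s(u, v)} u v E s t) : s(u, v) ∈ E := h.subset (Finset.mem_singleton_self _)

/-- The initial flag with the marked edge open: `u ↔ v` in `{z}`. [folklore] -/
theorem flag_true_marked {ω : Finset (Sym2 V)} (huv : u ≠ v) (hz : s(u, v) ∈ ω) :
    (true = true ↔ (openGraph (↑(ω ∩ {s(u, v)}) : BondConfig V)).Reachable u v) := by
  refine ⟨fun _ => ?_, fun _ => rfl⟩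
  rw [Finset.inter_singleton_of_mem hz, Finset.coe_singleton]
  exact Adj.reachable ((openGraph_adj _ u v).2 ⟨rfl, huv⟩)

/-- **`1{s ↔ t in ω ∪ z} = lastFlag true (rowOf ps ω)`** for a configuration `ω ⊆ E` avoiding the marked edge. [folklore] -/
theorem IsSpine.apConn_insert_marked_eq (h : IsSpine ps {s(u, v)} u v E s t) (huv : u ≠ v) {ω : Finset (Sym2 V)} (hω : ω ⊆ E) :
    apConn (insert s(u, v) ω) s t = if lastFlag true (rowOf ps ω) then 1 else 0 := by
  have hω' : insert s(u, v) ω ⊆ E := Finset.insert_subset h.marked_mem hω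
  have key := h.reach_iff huv (insert s(u, v) ω) hω' (flag_true_marked huv (Finset.mem_insert_self _ _))
  rw [rowOf_insert_of_notMem h.marked_notMem_parts] at key
  unfold apConn
  by_cases hr : (openGraph (↑(insert s(u, v) ω) : BondConfig V)).Reachable s t
  · rw [if_pos hr, if_pos (key.2 hr)]
  · rw [if_neg hr, if_neg (fun hh => hr (key.1 hh))]

/-- **`1{u ↔ v in ω ∪ st} = 1{runK S (rowOf ps ω) ≠ D}`** for a configuration `ω ⊆ E` avoiding the marked edge: wiring the terminals joins the
straddling pair, and the pair is dead iff the first visible part is a wall. [folklore] -/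
theorem IsSpine.apConn_insert_terminals_eq (h : IsSpine ps {s(u, v)} u v E s t) (huv : u ≠ v) {ω : Finset (Sym2 V)} (hω : ω ⊆ E)
    (hz : s(u, v) ∉ ω) : apConn (insert s(s, t) ω) u v = if runK .S (rowOf ps ω) = .D then 0 else 1 := by
  have hst : s ≠ t := (h.isTTSP (IsTTSP.edge huv)).ne
  have hstart : PairState.S.Holds (↑(ω ∩ {s(u, v)}) : BondConfig V) u v u v := by
    rw [coe_inter_singleton_of_not_mem hz]
    simp only [PairState.Holds]
    exact ⟨fun hr => huv (reachable_empty_iff.1 hr), Reachable.refl _, Reachable.refl _⟩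
  have key := h.pairState_holds ⟨s(u, v), Finset.mem_singleton_self _, Sym2.mem_mk_left _ _⟩
    ⟨s(u, v), Finset.mem_singleton_self _, Sym2.mem_mk_right _ _⟩ ω hω hstart
  have hcoe : (↑(insert s(s, t) ω) : BondConfig V) = ↑ω ∪ {s(s, t)} := by
    rw [Finset.coe_insert, Set.insert_eq, Set.union_comm]
  have m₁ : openGraph (↑ω : BondConfig V) ≤ openGraph (↑(insert s(s, t) ω) : BondConfig V) :=
    openGraph_mono (by rw [hcoe]; exact Set.subset_union_left)
  have hedge : (openGraph (↑(insert s(s, t) ω) : BondConfig V)).Reachable s t :=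
    Adj.reachable ((openGraph_adj _ s t).2 ⟨by rw [hcoe]; exact Or.inr rfl, hst⟩)
  unfold apConn
  -- the three final states
  rcases hrun : runK PairState.S (rowOf ps ω) with _ | _ | _
  · rw [hrun] at key
    simp only [PairState.Holds] at key
    rw [if_pos (key.mono m₁), if_neg (by decide)]
  · rw [hrun] at key
    simp only [PairState.Holds] at key
    rw [if_pos (((key.2.1.mono m₁).trans hedge).trans (key.2.2.mono m₁).symm), if_neg (by decide)]
  · rw [hrun] at key
    simp only [PairState.Holds] at key
    rw [hcoe, if_neg key, if_pos rfl]

variable [Fintype V]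

/-- The single marked edge has `|V| - 1` clusters. [cite: Grimmett2006, §1.2] -/
theorem clusterCount_marked_edge (huv : u ≠ v) :
    clusterCount (↑({s(u, v)} : Finset (Sym2 V)) : BondConfig V) ∅ + 1 = Fintype.card V := by
  have key := clusterCount_union_pair_add (∅ : BondConfig V) u v
  rw [if_neg (fun hr => huv (reachable_empty_iff.1 hr)), Set.empty_union, clusterCount_empty_card] at key
  rw [Finset.coe_singleton]
  exact key

/-- **`k(ω ∪ z) + L·|V| + 1 = |V| + Σ_p k(ω ∩ R_p) + adjP true (rowOf ps ω)`** for a configuration `ω ⊆ E` avoiding the marked edge (the row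
semantics of gen 14 with the inner composite `{z}` open). [cite: Grimmett2006, §1.4 eq. (1.20) (p. 15)] -/
theorem IsSpine.clusterCount_insert_marked (h : IsSpine ps {s(u, v)} u v E s t) (huv : u ≠ v) {ω : Finset (Sym2 V)} (hω : ω ⊆ E) :
    clusterCount (↑(insert s(u, v) ω) : BondConfig V) ∅ + ps.length * Fintype.card V + 1 =
      Fintype.card V + (ps.map fun p => clusterCount (↑(ω ∩ p.R) : BondConfig V) ∅).sum + adjP true (rowOf ps ω) := by
  have hω' : insert s(u, v) ω ⊆ E := Finset.insert_subset h.marked_mem hω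
  have key := h.clusterCount_eq huv (insert s(u, v) ω) hω' (flag_true_marked huv (Finset.mem_insert_self _ _))
  rw [rowOf_insert_of_notMem h.marked_notMem_parts, Finset.inter_singleton_of_mem (Finset.mem_insert_self _ _)] at key
  have hparts : (ps.map fun p => clusterCount (↑(insert s(u, v) ω ∩ p.R) : BondConfig V) ∅) =
      ps.map fun p => clusterCount (↑(ω ∩ p.R) : BondConfig V) ∅ :=
    List.map_congr_left fun p hp => by rw [Finset.insert_inter_of_notMem (h.marked_notMem_parts p hp)]
  rw [hparts] at key
  have hz := clusterCount_marked_edge (V := V) huv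
  omega

end Marked

/-! ### Through the dual word -/

section Dual

variable [Fintype V] {ps : List (SpinePart V)} {E T : Finset (Sym2 V)} {s t u v : V}

omit [Fintype V] in
/-- **`1{s ↮ t in C ∪ z} = lastP (row A of the dual word)`.** [folklore] -/
theorem IsSpine.dual_sign_A (h : IsSpine ps {s(u, v)} u v E s t) (huv : u ≠ v) (hT : T ⊆ E.erase s(u, v)) {C : Finset (Sym2 V)}
    (hC : C ⊆ T) :
    1 - apConn (insert s(u, v) C) s t = if lastP (sRowA ((spineWord ps T C).map dualLetter)) then 1 else 0 := by
  have hTE : T ⊆ E := hT.trans (Finset.erase_subset _ _)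
  rw [h.apConn_insert_marked_eq huv (hC.trans hTE), sRowA_map_dualLetter, lastP_map_other, sRowA_spineWord]
  cases lastFlag true (rowOf ps C) <;> simp

omit [Fintype V] in
/-- **`1{u ↔ v in (T ∖ C) ∪ st} = 1 - 1{headP (row B of the dual word)}`.** [folklore] -/
theorem IsSpine.dual_sign_B (h : IsSpine ps {s(u, v)} u v E s t) (huv : u ≠ v) (hT : T ⊆ E.erase s(u, v)) (C : Finset (Sym2 V)) :
    apConn (insert s(s, t) (T \ C)) u v = 1 - if headP (sRowB ((spineWord ps T C).map dualLetter)) then 1 else 0 := by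
  have hTE : T ⊆ E := hT.trans (Finset.erase_subset _ _)
  have hzT : s(u, v) ∉ T := fun hz => Finset.notMem_erase _ _ (hT hz)
  rw [h.apConn_insert_terminals_eq huv (Finset.sdiff_subset.trans hTE) (fun hz => hzT (Finset.sdiff_subset hz)),
    sRowB_map_dualLetter, headP_map_other, sRowB_spineWord]
  by_cases hD : runK PairState.S (rowOf ps (T \ C)) = PairState.D
  · rw [if_pos hD, decide_eq_true hD]; simp
  · rw [if_neg hD, decide_eq_false hD]; simp

omit [Fintype V] in
/-- `1{s ↔ t in (T∖C) ∪ z} = lastFlag true (row B)`. [folklore] -/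
theorem IsSpine.apConn_insert_marked_compl (h : IsSpine ps {s(u, v)} u v E s t) (huv : u ≠ v) (hT : T ⊆ E.erase s(u, v))
    (C : Finset (Sym2 V)) :
    apConn (insert s(u, v) (T \ C)) s t = if lastFlag true (sRowB (spineWord ps T C)) then 1 else 0 := by
  have hTE : T ⊆ E := hT.trans (Finset.erase_subset _ _)
  rw [h.apConn_insert_marked_eq huv (Finset.sdiff_subset.trans hTE), sRowB_spineWord]

omit [Fintype V] in
/-- The number of series letters of the word of a configuration is the number of series parts. [folklore] -/
theorem seriesCount_spineWord (ps : List (SpinePart V)) (T B : Finset (Sym2 V)) :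
    seriesCount (spineWord ps T B) = (ps.map fun p => if p.kind = Kind.W then 1 else 0).sum := by
  unfold seriesCount spineWord
  rw [List.map_map]
  exact congrArg List.sum (List.map_congr_left fun p _ => rfl)

/-- **The dual exponent identity on the support** (`s ↮ t in C ∪ z`):
`k(C∪z) + k((T∖C)∪z) + 1{s↔t in (T∖C)∪z} + 2L|V| + sRuns(dual w) + 2·#series = 2|V| + expSum + onesCount w + nP(dual w)`.
[cite: Grimmett2006, §1.4 eq. (1.20) (p. 15)] -/
theorem IsSpine.dual_exponent_identity (h : IsSpine ps {s(u, v)} u v E s t) (huv : u ≠ v) (hT : T ⊆ E.erase s(u, v))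
    {C : Finset (Sym2 V)} (hC : C ⊆ T) (hA : lastFlag true (sRowA (spineWord ps T C)) = false) :
    clusterCount (↑(insert s(u, v) C) : BondConfig V) ∅ + clusterCount (↑(insert s(u, v) (T \ C)) : BondConfig V) ∅ +
        (if lastFlag true (sRowB (spineWord ps T C)) then 1 else 0) + 2 * (ps.length * Fintype.card V) +
        sRuns ((spineWord ps T C).map dualLetter) + 2 * seriesCount (spineWord ps T C) =
      2 * Fintype.card V + expSum ps T C + onesCount (spineWord ps T C) + nP ((spineWord ps T C).map dualLetter) := by
  have hTE : T ⊆ E := hT.trans (Finset.erase_subset _ _)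
  have k1 := h.clusterCount_insert_marked huv (hC.trans hTE)
  have k2 := h.clusterCount_insert_marked huv ((Finset.sdiff_subset (s := T) (t := C)).trans hTE)
  rw [← sRowA_spineWord ps T C] at k1
  rw [← sRowB_spineWord ps T C] at k2
  have r1 := adjP_true_add (sRowA (spineWord ps T C))
  have r2 := adjP_true_add (sRowB (spineWord ps T C))
  rw [hA] at r1
  simp only [Bool.false_eq_true, if_false, add_zero] at r1
  have e := expSum_eq_two_sums ps T C
  have n := nP_add_two_mul_seriesCount (spineWord ps T C)
  have hruns : sRuns ((spineWord ps T C).map dualLetter) =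
      runsP ((sRowA (spineWord ps T C)).map Kind.other) + runsP ((sRowB (spineWord ps T C)).map Kind.other) := by
    unfold sRuns; rw [sRowA_map_dualLetter, sRowB_map_dualLetter]
  have hnP : nP (spineWord ps T C) = (sRowA (spineWord ps T C)).count .P + (sRowB (spineWord ps T C)).count .P := rfl
  rw [hruns]
  by_cases hB : lastFlag true (sRowB (spineWord ps T C)) = true
  · rw [hB] at r2; rw [if_pos hB]; simp only [if_true] at r2; omega
  · rw [if_neg hB]; rw [if_neg hB] at r2; omega

end Dual

end FK

end Summit.CriticalPhenomena.PercolationContinuityZ3.Theorems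

end
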